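import Literature.NumberTheory.Weil1964.AdelicMetaplecticThetaMajorants
import HarnessLib

/-!
# Scalar twists of sections into `Mp_ψ(W_𝔸)ᶜᵒⁿᵗ`

Two homomorphic lifts `s, s' : H → Mp_ψ(W_𝔸)` of the same map `H → Sp(W_𝔸)` differ by a character
`η : H → ℂˣ` valued in the CENTRE `{(1, c·id)}` of the metaplectic group [MoeglinVignerasWaldspurger1987,
Chap. 2 II.1 (B): the kernel of `(g, M) ↦ g` is the scalars].  This file constructs the twist
`s ⊗ η : h ↦ (1, η(h)·id) · s(h)` of a homomorphism `s : H →* Mp_ψ(W_𝔸)ᶜᵒⁿᵗ` by a character `η : H →* ℂˣ`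
and records what it does NOT change (the projection `π`, continuity for the topology of record, the
existence of theta majorants [Weil1964, Chap. III n° 41], the operators at points where `η = 1`) and what it
changes (`ω_ψ(s ⊗ η)(h) = η(h) · ω_ψ(s(h))`).  It is the algebraic half of the normalisation of a splitting of a
dual pair by an automorphic character (the `K_∞`-type of `ω_ψ ∘ s` is shifted by `η|_{K_∞}`).

* §1 `isLFContinuous_smul`, `scalarOp_mem_lfUnits`, `ofScalar_mem_adelicMpCont`, `adelicMpCont.ofScalar`
  (the central scalars `(1, c·id) ∈ Mp_ψ(W_𝔸)ᶜᵒⁿᵗ`), `proj_ofScalar`, `omega_ofScalar`, `ofScalar_mem_center`,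
  `mul_ofScalar_comm`, `commute_ofScalar`;
* §2 `adelicMpCont.twist s η` with `twist_apply`, `proj_twist`, `proj_comp_twist`, `omega_twist`,
  `coe_omega_twist_apply`, `twist_eq_of_eq_one`, `omega_twist_eq_of_eq_one`, `continuous_twist`;
* §3 `HasThetaMajorants.smul` (majorants survive a continuous scalar factor) and `hasThetaMajorants_twist`.

Data INPUT: none beyond [Weil1964] / [GelbartRogawski1991, §3.1] objects already in the tree. 0 records, 0 sorry.
-/

noncomputable section

open scoped Matrix TensorProduct
open NumberField Topology Filter Set

namespace Literature.NumberTheory.Automorphic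

variable {K : Type} [Field K] [NumberField K] {ι : Type} [Fintype ι]

/-- A scalar multiple of the identity is LF-continuous (one-term expansion `id ⊗ c·Φ_f`).
[cite: Weil1964, Chap. I n° 11 p. 155–156] -/
theorem isLFContinuous_smul (c : ℂ) :
    IsLFContinuous (c • LinearMap.id : ↥(piSchwartzBruhat K ι) →ₗ[ℂ] ↥(piSchwartzBruhat K ι)) :=
  fun Φf => ⟨Unit, inferInstance, fun _ => ContinuousLinearMap.id ℂ _, fun _ => c • Φf, fun φ => by
    rw [Finset.univ_unique, Finset.sum_singleton, LinearMap.smul_apply, LinearMap.id_apply,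
      ContinuousLinearMap.coe_id', id_eq, TensorProduct.tmul_smul, map_smul]⟩

end Literature.NumberTheory.Automorphic

namespace Literature.NumberTheory.Weil1964

open Literature.RepresentationTheory.HeisenbergGroup
open Literature.NumberTheory.Automorphic

variable {F : Type} [Field F] [NumberField F] {ι : Type} [Fintype ι] [DecidableEq ι]
variable {T : Matrix ι ι (AdeleRing (𝓞 F) F)}

/-! ## §1. The central scalars of `Mp_ψ(W_𝔸)ᶜᵒⁿᵗ` -/

omit [DecidableEq ι] in
/-- The scalar operator `c · id` of `𝒮(𝔸_F^ι)` and its inverse are LF-continuous. [folklore] -/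
theorem scalarOp_mem_lfUnits (c : ℂˣ) :
    scalarOp (S := ↥(piSchwartzBruhat F ι)) c ∈ lfUnits F ι := by
  refine ⟨(isLFContinuous_smul (c : ℂ)).congr fun _ => rfl,
    (isLFContinuous_smul ((c⁻¹ : ℂˣ) : ℂ)).congr fun Φ => ?_⟩
  rw [LinearEquiv.coe_coe, LinearEquiv.symm_apply_eq, scalarOp_apply, LinearMap.smul_apply, LinearMap.id_apply,
    smul_smul, Units.mul_inv, one_smul]

/-- `(1, c·id) ∈ Mp_ψ(W_𝔸)ᶜᵒⁿᵗ`. [cite: MoeglinVignerasWaldspurger1987, Chap. 2 II.1 (B)] -/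
theorem ofScalar_mem_adelicMpCont (c : ℂˣ) :
    MpPsi.ofScalar (adelicSchrodinger F ι T) c ∈ adelicMpCont F ι T :=
  scalarOp_mem_lfUnits c

variable (F ι T) in
/-- **The central scalars** `c ↦ (1, c·id) : ℂˣ →* Mp_ψ(W_𝔸)ᶜᵒⁿᵗ`.
[cite: MoeglinVignerasWaldspurger1987, Chap. 2 II.1 (B)] -/
def adelicMpCont.ofScalar : ℂˣ →* adelicMpCont F ι T :=
  (MpPsi.ofScalar (adelicSchrodinger F ι T)).codRestrict (adelicMpCont F ι T) ofScalar_mem_adelicMpCont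

/-- underlying pair. [folklore] -/
@[simp] theorem adelicMpCont.coe_ofScalar (c : ℂˣ) :
    ((adelicMpCont.ofScalar F ι T c : adelicMpCont F ι T) : adelicMp F ι T) =
      MpPsi.ofScalar (adelicSchrodinger F ι T) c := rfl

/-- `π(1, c·id) = 1`. [cite: MoeglinVignerasWaldspurger1987, Chap. 2 II.1 (B)] -/
@[simp] theorem adelicMpCont.proj_ofScalar (c : ℂˣ) :
    adelicMpCont.proj F ι T (adelicMpCont.ofScalar F ι T c) = 1 := rfl

/-- `ω_ψ(1, c·id) Φ = c • Φ`. [cite: GelbartRogawski1991, §3.1 p. 454] -/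
@[simp] theorem adelicMpCont.omega_ofScalar (c : ℂˣ) (Φ : piSchwartzBruhat F ι) :
    adelicMpCont.omega F ι T (adelicMpCont.ofScalar F ι T c) Φ = (c : ℂ) • Φ := rfl

/-- The scalars are central in `Mp_ψ(W_𝔸)ᶜᵒⁿᵗ`. [cite: MoeglinVignerasWaldspurger1987, Chap. 2 II.1 (B)] -/
theorem adelicMpCont.ofScalar_mem_center (c : ℂˣ) :
    adelicMpCont.ofScalar F ι T c ∈ Subgroup.center (adelicMpCont F ι T) := by
  rw [Subgroup.mem_center_iff]
  intro p
  apply Subtype.ext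
  exact (Subgroup.mem_center_iff.1 (MpPsi.ofScalar_mem_center (adelicSchrodinger F ι T) c)) (p : adelicMp F ι T)

/-- `p · (1, c·id) = (1, c·id) · p`. [cite: MoeglinVignerasWaldspurger1987, Chap. 2 II.1 (B)] -/
theorem adelicMpCont.mul_ofScalar_comm (c : ℂˣ) (p : adelicMpCont F ι T) :
    p * adelicMpCont.ofScalar F ι T c = adelicMpCont.ofScalar F ι T c * p :=
  (Subgroup.mem_center_iff.1 (adelicMpCont.ofScalar_mem_center c)) p

/-- `Commute` form of centrality (the hypothesis of `MonoidHom.noncommCoprod`).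
[cite: MoeglinVignerasWaldspurger1987, Chap. 2 II.1 (B)] -/
theorem adelicMpCont.commute_ofScalar (c : ℂˣ) (p : adelicMpCont F ι T) :
    Commute (adelicMpCont.ofScalar F ι T c) p :=
  (adelicMpCont.mul_ofScalar_comm c p).symm

/-! ## §2. The twist of a homomorphism by a character

Remark on elaboration: `Mp_ψ(W_𝔸)ᶜᵒⁿᵗ` is a subgroup of a subgroup of `Sp(W_𝔸) × GL(𝒮(𝔸_F^ι))`, and the
`rw` tactic is prohibitively slow on goals containing products of its elements (instance unification), while
definitional unfolding is cheap.  All identities below are therefore proved in term mode (`rfl`, `Subtype.ext`,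
`congrArg`/`Eq.trans` chains); consumers should likewise use them with `exact`/`refine`/`▸` rather than `rw`.
The homomorphism itself is Mathlib's `MonoidHom.noncommCoprod`. -/

section Twist

variable {H : Type*} [Group H]

variable (F ι T) in
/-- **Twist of a section by a character**: `(s ⊗ η)(h) = (1, η(h)·id) · s(h)`, a homomorphism because the
scalars are central (`MonoidHom.noncommCoprod` of `ofScalar ∘ η` and `s` along the diagonal of `H`).
[cite: MoeglinVignerasWaldspurger1987, Chap. 2 II.1 (B)] -/
def adelicMpCont.twist (s : H →* adelicMpCont F ι T) (η : H →* ℂˣ) : H →* adelicMpCont F ι T :=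
  (MonoidHom.noncommCoprod ((adelicMpCont.ofScalar F ι T).comp η) s
      (fun a b => adelicMpCont.commute_ofScalar (η a) (s b))).comp
    ((MonoidHom.id H).prod (MonoidHom.id H))

variable (s : H →* adelicMpCont F ι T) (η : H →* ℂˣ)

set_option maxHeartbeats 800000 in
/-- formula. [folklore] -/
theorem adelicMpCont.twist_apply (h : H) :
    adelicMpCont.twist F ι T s η h = adelicMpCont.ofScalar F ι T (η h) * s h := rfl

/-- The twist does not change the projection: `π((s ⊗ η)(h)) = π(s(h))` (checked on vectors of `W_𝔸`, where
both sides are `π(s(h)) w` definitionally). [cite: MoeglinVignerasWaldspurger1987, Chap. 2 II.1 (B)] -/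
theorem adelicMpCont.proj_twist (h : H) :
    adelicMpCont.proj F ι T (adelicMpCont.twist F ι T s η h) = adelicMpCont.proj F ι T (s h) :=
  Subtype.ext (LinearEquiv.ext fun _ => rfl)

/-- `π ∘ (s ⊗ η) = π ∘ s` — a twisted splitting lifts the same homomorphism into `Sp(W_𝔸)`.
[cite: MoeglinVignerasWaldspurger1987, Chap. 2 II.1 (B)] -/
theorem adelicMpCont.proj_comp_twist :
    (adelicMpCont.proj F ι T).comp (adelicMpCont.twist F ι T s η) = (adelicMpCont.proj F ι T).comp s :=
  MonoidHom.ext fun h => adelicMpCont.proj_twist s η h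

/-- `ω_ψ((s ⊗ η)(h)) Φ = η(h) • ω_ψ(s(h)) Φ` (definitionally). [cite: GelbartRogawski1991, §3.1 p. 454] -/
theorem adelicMpCont.omega_twist (h : H) (Φ : piSchwartzBruhat F ι) :
    adelicMpCont.omega F ι T (adelicMpCont.twist F ι T s η h) Φ =
      ((η h : ℂˣ) : ℂ) • adelicMpCont.omega F ι T (s h) Φ := rfl

/-- pointwise form of `omega_twist`. [folklore] -/
theorem adelicMpCont.coe_omega_twist_apply (h : H) (Φ : piSchwartzBruhat F ι) (x : ι → AdeleRing (𝓞 F) F) :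
    ((adelicMpCont.omega F ι T (adelicMpCont.twist F ι T s η h) Φ : piSchwartzBruhat F ι) :
        (ι → AdeleRing (𝓞 F) F) → ℂ) x =
      ((η h : ℂˣ) : ℂ) * ((adelicMpCont.omega F ι T (s h) Φ : piSchwartzBruhat F ι) :
        (ι → AdeleRing (𝓞 F) F) → ℂ) x := rfl

/-- Where the character is trivial the twist changes nothing: `η(γ) = 1 ⇒ (s ⊗ η)(γ) = s(γ)` (used on rational
points, where an automorphic `η` is trivial). [folklore] -/
theorem adelicMpCont.twist_eq_of_eq_one {γ : H} (hγ : η γ = 1) :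
    adelicMpCont.twist F ι T s η γ = s γ :=
  (adelicMpCont.twist_apply s η γ).trans <|
    (congrArg (fun c : ℂˣ => adelicMpCont.ofScalar F ι T c * s γ) hγ).trans <|
      (congrArg (· * s γ) (map_one (adelicMpCont.ofScalar F ι T))).trans (one_mul (s γ))

/-- `η(γ) = 1 ⇒ ω_ψ((s ⊗ η)(γ)) = ω_ψ(s(γ))` — in particular `Θ`-invariance at such `γ` is inherited. [folklore] -/
theorem adelicMpCont.omega_twist_eq_of_eq_one {γ : H} (hγ : η γ = 1) :
    adelicMpCont.omega F ι T (adelicMpCont.twist F ι T s η γ) = adelicMpCont.omega F ι T (s γ) :=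
  congrArg (adelicMpCont.omega F ι T) (adelicMpCont.twist_eq_of_eq_one s η hγ)

/-- **Continuity**: for the topology of record on `Mp_ψ(W_𝔸)ᶜᵒⁿᵗ` (initial for the `π`-orbit maps and the
matrix coefficients), the twist of a continuous `s` by a continuous character is continuous.
[cite: Weil1964, Chap. III n° 39 p. 189] -/
theorem adelicMpCont.continuous_twist [TopologicalSpace H] (hs : Continuous s)
    (hη : Continuous fun h => ((η h : ℂˣ) : ℂ)) :
    Continuous (adelicMpCont.twist F ι T s η) := by
  have hs' := (continuous_into_adelicMp_iff _).1 ((continuous_into_adelicMpCont_iff _).1 hs)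
  refine (continuous_into_adelicMpCont_iff _).2 ((continuous_into_adelicMp_iff _).2 ⟨fun w => ?_, fun Φ x => ?_⟩)
  · exact (hs'.1 w).congr fun h =>
      congrArg (fun g : ↥(symplecticGroup (polar (adelicForm F ι T))) =>
        ((g : ↥(symplecticGroup (polar (adelicForm F ι T)))) :
          ((ι → AdeleRing (𝓞 F) F) × (ι → AdeleRing (𝓞 F) F)) ≃ₗ[AdeleRing (𝓞 F) F]
            ((ι → AdeleRing (𝓞 F) F) × (ι → AdeleRing (𝓞 F) F))) w)
        (adelicMpCont.proj_twist s η h).symm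
  · exact (hη.mul (hs'.2 Φ x)).congr fun h => (adelicMpCont.coe_omega_twist_apply s η h Φ x).symm

end Twist

/-! ## §3. Theta majorants survive a scalar twist -/

section Majorants

variable {G : Type*} [TopologicalSpace G] {ρ : G → piSchwartzBruhat F ι → piSchwartzBruhat F ι}

omit [DecidableEq ι] in
/-- A continuous scalar factor `c(g)` does not destroy theta majorants: locally `|c| ≤ |c(g₀)| + 1`, so
`(|c(g₀)| + 1) · u` majorises `c(g) • ρ(g)Φ` on rational points. [cite: Weil1964, Chap. III n° 41, Lemme 5 p. 192] -/
theorem HasThetaMajorants.smul (h : HasThetaMajorants ρ) {c : G → ℂ} (hc : Continuous c) :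
    HasThetaMajorants fun g Φ => c g • ρ g Φ := by
  refine ⟨fun Φ ξ => ?_, fun Φ g₀ => ?_⟩
  · show Continuous fun g => c g * ((ρ g Φ : piSchwartzBruhat F ι) : (ι → AdeleRing (𝓞 F) F) → ℂ) (ratPt F ι ξ)
    exact hc.mul (h.continuous_eval Φ ξ)
  · obtain ⟨V, hV, u, hu, hle⟩ := h.exists_majorant Φ g₀
    have hcb : {g | ‖c g‖ < ‖c g₀‖ + 1} ∈ 𝓝 g₀ :=
      (isOpen_lt (continuous_norm.comp hc) continuous_const).mem_nhds (by simp)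
    refine ⟨V ∩ {g | ‖c g‖ < ‖c g₀‖ + 1}, inter_mem hV hcb, fun ξ => (‖c g₀‖ + 1) * u ξ, hu.mul_left _,
      fun ξ g hg => ?_⟩
    rw [show ((c g • ρ g Φ : piSchwartzBruhat F ι) : (ι → AdeleRing (𝓞 F) F) → ℂ) (ratPt F ι ξ) =
        c g * ((ρ g Φ : piSchwartzBruhat F ι) : (ι → AdeleRing (𝓞 F) F) → ℂ) (ratPt F ι ξ) from rfl, norm_mul]
    exact mul_le_mul (le_of_lt hg.2) (hle ξ g hg.1) (norm_nonneg _) (by positivity)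

variable {H : Type*} [Group H] [TopologicalSpace H]

/-- **Theta majorants for a twisted section**: if `h ↦ ω_ψ(s(h))` has theta majorants and `η` is continuous,
so does `h ↦ ω_ψ((s ⊗ η)(h)) = η(h) ω_ψ(s(h))`. [cite: Weil1964, Chap. III n° 41, Lemme 5 p. 192] -/
theorem hasThetaMajorants_twist (s : H →* adelicMpCont F ι T) (η : H →* ℂˣ)
    (hρ : HasThetaMajorants (F := F) fun h Φ => adelicMpCont.omega F ι T (s h) Φ)
    (hη : Continuous fun h => ((η h : ℂˣ) : ℂ)) :
    HasThetaMajorants (F := F) fun h Φ => adelicMpCont.omega F ι T (adelicMpCont.twist F ι T s η h) Φ :=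
  hρ.smul hη

end Majorants

end Literature.NumberTheory.Weil1964

end
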